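import Summits.BirchSwinnertonDyer.BirchSwinnertonDyer.Theorems.ResidualThetaTransportAtTwoDefs
import Summits.BirchSwinnertonDyer.BirchSwinnertonDyer.Theorems.ResidualThetaTransportAtTwoResidualSignedLambdaLowerCMAtTwoFourTermOneSided
import Summits.BirchSwinnertonDyer.BirchSwinnertonDyer.Theorems.ResidualThetaTransportAtTwoPollackPairKUnique
import Summits.BirchSwinnertonDyer.BirchSwinnertonDyer.Theorems.ResidualThetaTransportAtTwoResidualSignedLambdaLowerCMAtTwoSelmerDualFinite
import HarnessLib

/-!
# Stub-ideation k3 (g24) for `stub_cmLambdaLower` — TECHNIQUE «decomposition (split into sub-stubs with a provable glue)»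

Crux (R≥)ᵖ `ResidualThetaCountLowerPureAtTwo` (stmt-BirchSwinnertonDyer-26074), stub `stub_cmLambdaLower` = RSL_g, whose
PRINT-HOLD node is S3″ = `KatoZetaCMFormAtTwoSupply` (stmt-24105).  The director's default (a) (bus 2026-08-29T10:14Z) opens
S3″ into child A (reciprocity values, g-side) and child B := B⁻ (package-free λ-inequality); the split verb waits for
«A/B rc 0 + k3 glue lands».  THIS FILE is the KERNEL OF THAT k3 GLUE, written AT THE PINS and kernel-checked (no `sorry`,
no new definition, no instance, imports = landed Theorems only):

* §1 two generic lemmas: a class whose Coleman column generates a non-zero principal ideal is `Λ`-torsion-free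
  (`torsionFree_of_column`), and torsion of `H/Λ(c•z)` from torsion of `H/Λz` (`isTorsion_quotient_span_smul`);
* §2 `IsAdicComplete 𝔪 𝒪` for `𝒪 = coeffO S` from the landed precompleteness (`isAdicComplete_maximalIdeal_coeffO`);
* §3 **`s3body_of_stations`** — for ONE pin bundle `π` and ONE class `z₀`, the five typed STATIONS
  (E) trivialisation `e : Λⁿ ≃+ Λ_𝒪`, `Λ_𝒪`-semilinear on `Λ_𝒪 z₀` (k3-g19 `exists_trivialisation`),
  (R) the explicit-reciprocity value relation `C ν · e(𝒸 z₀) = D·(L⁻·u)` (k2-g20 `hERL_of_mazurTateValues`, = child A's output),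
  (DESC) the two-currency descent `f·λ_𝒪(Λ_𝒪/(h)) ≤ λ_{ℤ₂}(Λⁿ/𝒸(Λ_𝒪 z))` along a column identity (k2-g18 PLAN 1 / critic's at-pins cert),
  (B⁻) `H/Λ_𝒪 z₀` torsion with `λ_𝒪(H/Λ_𝒪 z₀) ≤ λ_𝒪(Sel₀^∨)` (child B, k1-g24 `ii_clauses_of_compositeB`),
  (W-d) `λ_𝒪(Λ_𝒪/(L⁻)) = d` (landed `LambdaLowerBoundO…Weierstrass`),
  IMPLY THE BODY OF S3″ VERBATIM (`Set.range ι ↦ S`) with the witnesses `z := C ν • z₀`, `D := D`.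
  The proof certifies the HEADLINE of the card: S3″'s joint `∃ z D` imposes NO COUPLING between the two children — the
  reciprocity decoration `D` is absorbed by the slack `+ λ_𝒪(Λ_𝒪/(D))` of clause (ii) (both sides of (ii) are computed at
  the PRIMITIVE class `z₀`; the constant rescaling `ν` costs `λ_𝒪(Λ_𝒪/(C ν)) = 0`, landed
  `CharIdealLambda.finrank_baseChange_quotient_span_C_eq_zero`), and the torsion-freeness of `z₀` that the decoration
  shift needs is READ OFF the column identity (no appeal to Kato 12.4 (2) for it).

HONEST FRAMING: theorems only; the stations are HYPOTHESES (their suppliers are the cited sketches / the two children /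
landed files); nothing here proves (R≥)ᵖ, RSL_g, S3″, child A or child B; BSD is NOT proved by any of this.

References: [Kato2004Asterisque] Thm. 12.4 (2), Thm. 12.5 (pp. 221–222), §13.8, §15.16; [Kobayashi2003] Thm. 6.2, (8.23);
[Washington1997] §7.1 Thm. 7.3, §13.2; [NeukirchANT1999] Ch. II (4.8).
-/

set_option autoImplicit false
-- the Cruxes namespace of this sub repeats the summit name by design (D-0017 nested layout)
set_option linter.dupNamespace false

noncomputable section

open scoped TensorProduct Classical

namespace Summit.BirchSwinnertonDyer.BirchSwinnertonDyer.Cruxes.ResidualThetaCountLowerPureAtTwo.SideaK3G24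

open Literature.NumberTheory.EllipticCurves Literature.NumberTheory.EllipticCurves.GreenbergSelmer
open Literature.NumberTheory.GaloisRepresentations NumberField IsDedekindDomain Field
open Summit.BirchSwinnertonDyer.BirchSwinnertonDyer.Theorems
open Summit.BirchSwinnertonDyer.BirchSwinnertonDyer.Theorems.OnePair

universe u v w

/-! ## §1 Generic lemmas -/

section Generic

variable {Λ : Type u} [CommRing Λ] [IsDomain Λ] {H : Type v} [AddCommGroup H] [Module Λ H]

/-- **A class with a non-zero semilinear column is `Λ`-torsion-free.** If an additive functional `col : H → Λ'` into a ring
without zero divisors satisfies `col (r • z) = r * c` on the line `Λ z` with `c ≠ 0`, then `a • z = 0 ⇒ a = 0`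
(the column of `0 = 0 • z` is `0`). [cite: Kato2004Asterisque, Thm. 12.4 (2) (p. 221)] -/
theorem torsionFree_of_column (col : H → Λ) (z : H) (c : Λ) (hc : c ≠ 0)
    (hcol : ∀ r : Λ, col (r • z) = r * c) (a : Λ) (ha : a • z = 0) : a = 0 := by
  have h0 : col (0 : H) = 0 := by simpa using hcol 0
  have h1 : a * c = 0 := by rw [← hcol a, ha, h0]
  exact (mul_eq_zero.mp h1).resolve_right hc

/-- **`H/Λ(c•z)` is torsion if `H/Λz` is** (`c ≠ 0`; the extra layer `Λz/Λcz ≅ Λ/(c)` is `c`-torsion).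
[cite: Washington1997, §13.2] -/
theorem isTorsion_quotient_span_smul (z : H) (c : Λ) (hc : c ≠ 0)
    (htors : Module.IsTorsion Λ (H ⧸ Submodule.span Λ ({z} : Set H))) :
    Module.IsTorsion Λ (H ⧸ Submodule.span Λ ({c • z} : Set H)) := by
  intro x
  induction x using Submodule.Quotient.induction_on with
  | H y =>
    obtain ⟨⟨a, ha⟩, hay⟩ := @htors (Submodule.Quotient.mk y)
    rw [Submonoid.mk_smul, ← Submodule.Quotient.mk_smul, Submodule.Quotient.mk_eq_zero,
      Submodule.mem_span_singleton] at hay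
    obtain ⟨b, hb⟩ := hay
    have ha0 : a ≠ 0 := nonZeroDivisors.ne_zero ha
    refine ⟨⟨c * a, mem_nonZeroDivisors_of_ne_zero (mul_ne_zero hc ha0)⟩, ?_⟩
    rw [Submonoid.mk_smul, ← Submodule.Quotient.mk_smul, Submodule.Quotient.mk_eq_zero, mul_smul, ← hb, smul_comm]
    exact Submodule.smul_mem _ _ (Submodule.mem_span_singleton_self _)

/-- **Rank one ⇒ the zeta quotient is torsion.** Over a domain `Λ`, if `H` has `Λ`-rank `1` and `z ∈ H` is `Λ`-torsion-free,
then `H/Λz` is a torsion module (rank–nullity: `rank(H/Λz) + rank(Λz) = 1` with `Λz ≅ Λ`).  With `torsionFree_of_column`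
this makes the torsion conjunct of child B a CONSEQUENCE of Kato 12.4 (2) (`rank_{Λ_𝒪} 𝐇¹ = 1`, conjunct 2 of S3″) and the
column identity of child A. [cite: Kato2004Asterisque, Thm. 12.4 (2) (p. 221)] -/
theorem isTorsion_quotient_span_of_rank_eq_one (hrk : Module.rank Λ H = 1) (z : H) (hz : ∀ a : Λ, a • z = 0 → a = 0) :
    Module.IsTorsion Λ (H ⧸ Submodule.span Λ ({z} : Set H)) := by
  rw [← rank_eq_zero_iff_isTorsion]
  have hinj : Function.Injective (LinearMap.toSpanSingleton Λ H z) := by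
    intro a b hab
    rw [LinearMap.toSpanSingleton_apply, LinearMap.toSpanSingleton_apply, ← sub_eq_zero, ← sub_smul] at hab
    exact sub_eq_zero.mp (hz _ hab)
  have h1 : Module.rank Λ (Submodule.span Λ ({z} : Set H)) = 1 := by
    have e : Λ ≃ₗ[Λ] Submodule.span Λ ({z} : Set H) :=
      (LinearEquiv.ofInjective _ hinj).trans (LinearEquiv.ofEq _ _ (LinearMap.span_singleton_eq_range Λ H z).symm)
    have he := e.lift_rank_eq
    rw [Module.rank_self, Cardinal.lift_one] at he
    exact Cardinal.lift_eq_one.mp he.symm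
  have h2 := rank_quotient_add_rank_of_isDomain (Submodule.span Λ ({z} : Set H))
  rw [h1, hrk] at h2
  have hlt : Module.rank Λ (H ⧸ Submodule.span Λ ({z} : Set H)) < Cardinal.aleph0 :=
    lt_of_le_of_lt ((self_le_add_right _ 1).trans_eq h2) Cardinal.one_lt_aleph0
  obtain ⟨m, hm⟩ := Cardinal.lt_aleph0.1 hlt
  rw [hm] at h2 ⊢
  norm_cast at h2
  have hm0 : m = 0 := by omega
  rw [hm0, Nat.cast_zero]

end Generic

/-! ## §2 `𝒪 = coeffO S` is `𝔪`-adically complete (from the landed precompleteness) -/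

section Integers

variable {S : Set (PadicAlgCl 2)} [FiniteDimensional ℚ_[2] (padicCoeffField S)]

/-- **`𝒪 = padicCoeffIntegers S` is `𝔪`-adically complete** (for `ℚ₂(S)/ℚ₂` finite; `𝔪 = (ϖ)`, `𝒪` is `(ϖ)`-precomplete by
`LambdaLowerBoundO.isPrecomplete_span_of_irreducible` (…SelmerDualFinite), and Hausdorff as a Noetherian local ring).
[cite: NeukirchANT1999, Ch. II (4.8)] -/
theorem isAdicComplete_maximalIdeal_coeffO [IsDiscreteValuationRing (coeffO S)] :
    IsAdicComplete (IsLocalRing.maximalIdeal (coeffO S)) (coeffO S) := by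
  obtain ⟨ϖ, hϖ⟩ := IsDiscreteValuationRing.exists_irreducible (coeffO S)
  have hm : IsLocalRing.maximalIdeal (coeffO S) = Ideal.span {ϖ} :=
    (IsDiscreteValuationRing.irreducible_iff_uniformizer ϖ).mp hϖ
  haveI : IsPrecomplete (IsLocalRing.maximalIdeal (coeffO S)) (coeffO S) := by
    rw [hm]; exact LambdaLowerBoundO.isPrecomplete_span_of_irreducible S hϖ
  exact { (inferInstance : IsHausdorff (IsLocalRing.maximalIdeal (coeffO S)) (coeffO S)),
    (inferInstance : IsPrecomplete (IsLocalRing.maximalIdeal (coeffO S)) (coeffO S)) with }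

end Integers

/-! ## §3 The top assembly AT THE PINS: typed stations ⟹ the body of S3″ -/

section Assembly

variable {S : Set (PadicAlgCl 2)} {W : WeierstrassCurve ℚ} [W.IsElliptic] {κ : ZpExtension ℚ 2} {γ : absoluteGaloisGroup ℚ}
  {S₀ : Finset (HeightOneSpectrum (𝓞 ℚ))} {n : ℕ} {ρ : FramedGaloisRep ℚ ↥(padicCoeffIntegers S) 2}
  {Θ : ∀ v : HeightOneSpectrum (𝓞 ℚ), ((2 : ℕ) : 𝓞 ℚ) ∈ v.asIdeal → (Cofree ρ ↥(padicCoeffField S) ≃+ (Fin n → ↥(W.geomPrimaryTorsion 2)))}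
  {hΘ : ∀ v hv (δ : absoluteGaloisGroup (v.adicCompletion ℚ)) m i,
    Θ v hv (resGalOfEmb (closureEmb (K := ℚ) (v.adicCompletion ℚ)) δ • m) i = resGalOfEmb (closureEmb (K := ℚ) (v.adicCompletion ℚ)) δ • Θ v hv m i}
  {I : Kato2004.IwasawaH1DataCoeff (FramedGaloisRep.toGaloisRep ρ) 2 κ γ}
  {Sg : AddSubgroup (subgroupH1 κ.kerSubgroup (Cofree ρ ↥(padicCoeffField S)))} [Module ↥(padicCoeffIntegers S) ↥Sg]

set_option maxHeartbeats 1600000 in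
/-- **The pen's k3 target, kernel at the pins (PROVED): `z := z`, `D := μt`.** For a pin bundle `π`, `L⁻ ≠ 0` with
`λ_𝒪(Λ_𝒪/(L⁻)) = d` (W-d), ONE class `z` (child A's valued class itself — no renormalisation), an additive `e : Λⁿ ≃+ Λ_𝒪` that is
`Λ_𝒪`-semilinear on `Λ_𝒪 z` through `𝒸` (E), the two-currency descent (DESC), the value relation `C ν · e(𝒸 z) = D·(L⁻·u)`,
`ν, D, u ≠ 0` (R = child A through the H-MT sockets; `D = μt` may be a NON-constant power series, `u` merely non-zero), and child B's
clause VERBATIM at `D` — `Frac ⊗ 𝐇¹/Λ_𝒪 z` finite ∧ `λ_𝒪(𝐇¹/Λ_𝒪 z) ≤ λ_𝒪(Sel₀^∨) + λ_𝒪(Λ_𝒪/(D))` (pen's `KatoZetaAlgebraicSideCMAtTwo`,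
evidence #4 on 24105) — the body of S3″ holds with the SAME `z` and `D`: the (ii)-half is the identity, the (i)-half is
`f·(d + λ(Λ/D)) ≤ f·(λ(Λ/u) + d + λ(Λ/D)) = f·λ(Λ/(D·L⁻·u)) = f·λ(Λ/(C ν · e 𝒸 z)) = f·λ(Λ/(e 𝒸 z)) ≤ λ_{ℤ₂}(Λⁿ/𝒸(Λ_𝒪 z))`
(constants are `λ`-invisible: landed `CharIdealLambda.finrank_baseChange_quotient_span_C_mul_eq`). No `Module.Finite 𝐇¹`, no torsion
hypothesis, no decoration lemma is consumed on this path. [cite: Kato2004Asterisque, Thm. 12.5 (1)–(2) (pp. 221–222), §13.8, §15.16 (p. 265)]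
[cite: Washington1997, §13.2] -/
theorem s3body_sameClass_of_stations [IsDiscreteValuationRing (coeffO S)] [IsAdicComplete (IsLocalRing.maximalIdeal (coeffO S)) (coeffO S)]
    [Module (coeffO S) I.H] [IsScalarTower (coeffO S) (IwasawaAlgebraO S) I.H]
    (π : OnePairPins S W κ γ S₀ n ρ Θ hΘ I Sg) {Lm : IwasawaAlgebraO S} {d : ℕ} (hLm : Lm ≠ 0)
    (hd : lamO S (IwasawaAlgebraO S ⧸ Ideal.span {Lm}) = d) (z : I.H)
    -- (E) the trivialisation, `Λ_𝒪`-semilinear on `Λ_𝒪 z` (k3-g19 `exists_trivialisation`, second conjunct, `S := Λ_𝒪 z`)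
    (e : (Fin n → PowerSeries ℤ_[2]) ≃+ IwasawaAlgebraO S)
    (hlin : ∀ (s : IwasawaAlgebraO S) (x : I.H), x ∈ Submodule.span (IwasawaAlgebraO S) ({z} : Set I.H) →
      e (π.cvec (s • x)) = s * e (π.cvec x))
    -- (DESC) two-currency descent along a column identity (k2-g18 PLAN 1 `iD_count`; critic's at-pins cert `i_clauses_at_onePair`)
    (hDesc : ∀ (z : I.H) (h : IwasawaAlgebraO S), h ≠ 0 → (∀ r : IwasawaAlgebraO S, e (π.cvec (r • z)) = r * h) →
      Module.Finite ℚ_[2] (TensorProduct ℤ_[2] ℚ_[2] (π.colocdQuot z)) ∧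
        π.f * lamO S (IwasawaAlgebraO S ⧸ Ideal.span {h}) ≤ lamTwo 2 (π.colocdQuot z))
    -- (R) the value relation (child A ∘ H-MT sockets S127/S129; k2-g20 `hERL_of_mazurTateValues` shape)
    (ν : coeffO S) (D u : IwasawaAlgebraO S) (hν : ν ≠ 0) (hD : D ≠ 0) (hu : u ≠ 0)
    (hval : PowerSeries.C ν * e (π.cvec z) = D * (Lm * u))
    -- (B) child B's clause for this valued class, VERBATIM at `D`
    (hB : Module.Finite (FractionRing (coeffO S)) (TensorProduct (coeffO S) (FractionRing (coeffO S)) (zetaQuot I z)) ∧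
      lamO S (zetaQuot I z) ≤ lamO S (CharacterModule ↥π.Sel₀) + lamO S (IwasawaAlgebraO S ⧸ Ideal.span {D})) :
    ∃ (z : I.H) (D : IwasawaAlgebraO S), D ≠ 0 ∧ Module.Finite ℚ_[2] (TensorProduct ℤ_[2] ℚ_[2] (π.colocdQuot z)) ∧
      π.f * (d + lamO S (IwasawaAlgebraO S ⧸ Ideal.span {D})) ≤ lamTwo 2 (π.colocdQuot z) ∧
      Module.Finite (FractionRing (coeffO S)) (TensorProduct (coeffO S) (FractionRing (coeffO S)) (zetaQuot I z)) ∧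
      lamO S (zetaQuot I z) ≤ lamO S (CharacterModule ↥π.Sel₀) + lamO S (IwasawaAlgebraO S ⧸ Ideal.span {D}) := by
  have hDLu : D * (Lm * u) ≠ 0 := mul_ne_zero hD (mul_ne_zero hLm hu)
  have hez : e (π.cvec z) ≠ 0 := by
    intro h0
    apply hDLu
    rw [← hval, h0, mul_zero]
  have hcol : ∀ r : IwasawaAlgebraO S, e (π.cvec (r • z)) = r * e (π.cvec z) := fun r ↦
    hlin r z (Submodule.mem_span_singleton_self z)
  refine ⟨z, D, hD, (hDesc z _ hez hcol).1, ?_, hB.1, hB.2⟩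
  have h1 := (hDesc z _ hez hcol).2
  have h0 : lamO S (IwasawaAlgebraO S ⧸ Ideal.span {e (π.cvec z)}) =
      lamO S (IwasawaAlgebraO S ⧸ Ideal.span {(PowerSeries.C ν : IwasawaAlgebraO S) * e (π.cvec z)}) :=
    (CharIdealLambda.finrank_baseChange_quotient_span_C_mul_eq (FractionRing (coeffO S)) hν hez).symm
  have h2 : lamO S (IwasawaAlgebraO S ⧸ Ideal.span {D * (Lm * u)}) =
      lamO S (IwasawaAlgebraO S ⧸ Ideal.span {Lm * u}) + lamO S (IwasawaAlgebraO S ⧸ Ideal.span {D}) :=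
    CharIdealLambda.finrank_baseChange_quotient_span_mul_eq_add (FractionRing (coeffO S)) hD (mul_ne_zero hLm hu)
  have h3 : lamO S (IwasawaAlgebraO S ⧸ Ideal.span {Lm * u}) =
      lamO S (IwasawaAlgebraO S ⧸ Ideal.span {u}) + lamO S (IwasawaAlgebraO S ⧸ Ideal.span {Lm}) :=
    CharIdealLambda.finrank_baseChange_quotient_span_mul_eq_add (FractionRing (coeffO S)) hLm hu
  rw [h0, hval, h2, h3, hd] at h1
  calc π.f * (d + lamO S (IwasawaAlgebraO S ⧸ Ideal.span {D}))
      ≤ π.f * (lamO S (IwasawaAlgebraO S ⧸ Ideal.span {u}) + d + lamO S (IwasawaAlgebraO S ⧸ Ideal.span {D})) :=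
        Nat.mul_le_mul_left _ (by omega)
    _ ≤ lamTwo 2 (π.colocdQuot z) := h1

set_option maxHeartbeats 1600000 in
/-- **S3″'s body from the stations (the k3 glue at the pins; PROVED).** For a pin bundle `π`, a class `z₀ ∈ 𝐇¹_Γ(T_ρ)` and
`L⁻ ≠ 0` with `λ_𝒪(Λ_𝒪/(L⁻)) = d` (W-d): given (E) an additive `e : Λⁿ ≃+ Λ_𝒪` that is `Λ_𝒪`-semilinear on `Λ_𝒪 z₀` through
the Coleman coordinates `𝒸`, (R) `C ν · e(𝒸 z₀) = D·(L⁻·u)` with `ν, D, u ≠ 0` (child A's output in k2-g20's shape), (DESC) the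
two-currency descent along column identities, and (B) `𝐇¹/Λ_𝒪 z₀` torsion with `λ_𝒪(𝐇¹/Λ_𝒪 z₀) ≤ λ_𝒪(Sel₀^∨) + λ_𝒪(Λ_𝒪/(D))`
(child B's output — the slack `λ_𝒪(Λ_𝒪/(D))` is ALLOWED on the B-side with the same `D`, so an imprimitive class is fine; the
primitive composite B⁻ simply does not use it), the body of `KatoZetaCMFormAtTwoSupply` holds with `z := C ν • z₀` and the SAME
`D`: clause (i_D) by `λ(Λ/(D·L⁻·u)) = λ(Λ/u) + d + λ(Λ/D) ≥ d + λ(Λ/D)`, clause (ii) by the decoration shift at the constant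
`C ν` (`λ(𝐇¹/Λ C ν z₀) = λ(𝐇¹/Λ z₀) + 0`).  The `Λ_𝒪`-torsion-freeness of `z₀` needed by the shift is read off the column.
[cite: Kato2004Asterisque, Thm. 12.5 (1)–(2) (pp. 221–222), §13.8] [cite: Washington1997, §13.2] -/
theorem s3body_of_stations [IsDiscreteValuationRing (coeffO S)] [IsAdicComplete (IsLocalRing.maximalIdeal (coeffO S)) (coeffO S)]
    [Module (coeffO S) I.H] [IsScalarTower (coeffO S) (IwasawaAlgebraO S) I.H]
    (π : OnePairPins S W κ γ S₀ n ρ Θ hΘ I Sg) {Lm : IwasawaAlgebraO S} {d : ℕ} (hLm : Lm ≠ 0)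
    (hd : lamO S (IwasawaAlgebraO S ⧸ Ideal.span {Lm}) = d)
    (hIfg : Module.Finite (IwasawaAlgebraO S) I.H) (z₀ : I.H)
    -- (E) the trivialisation, `Λ_𝒪`-semilinear on `Λ_𝒪 z₀` (k3-g19 `exists_trivialisation`, second conjunct)
    (e : (Fin n → PowerSeries ℤ_[2]) ≃+ IwasawaAlgebraO S)
    (hlin : ∀ (s : IwasawaAlgebraO S) (x : I.H), x ∈ Submodule.span (IwasawaAlgebraO S) ({z₀} : Set I.H) →
      e (π.cvec (s • x)) = s * e (π.cvec x))
    -- (DESC) two-currency descent along a column identity (k2-g18 PLAN 1 `iD_count`; critic's at-pins cert)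
    (hDesc : ∀ (z : I.H) (h : IwasawaAlgebraO S), h ≠ 0 → (∀ r : IwasawaAlgebraO S, e (π.cvec (r • z)) = r * h) →
      Module.Finite ℚ_[2] (TensorProduct ℤ_[2] ℚ_[2] (π.colocdQuot z)) ∧
        π.f * lamO S (IwasawaAlgebraO S ⧸ Ideal.span {h}) ≤ lamTwo 2 (π.colocdQuot z))
    -- (R) the reciprocity value relation (k2-g20 `hERL_of_mazurTateValues`; = child A composed with H-MT)
    (ν : coeffO S) (D u : IwasawaAlgebraO S) (hν : ν ≠ 0) (hD : D ≠ 0) (hu : u ≠ 0)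
    (hval : PowerSeries.C ν * e (π.cvec z₀) = D * (Lm * u))
    -- (B) child B at the class `z₀`, slack `λ(Λ/(D))` allowed
    (htors : Module.IsTorsion (IwasawaAlgebraO S) (zetaQuot I z₀))
    (hB : lamO S (zetaQuot I z₀) ≤ lamO S (CharacterModule ↥π.Sel₀) + lamO S (IwasawaAlgebraO S ⧸ Ideal.span {D})) :
    ∃ (z : I.H) (D : IwasawaAlgebraO S), D ≠ 0 ∧ Module.Finite ℚ_[2] (TensorProduct ℤ_[2] ℚ_[2] (π.colocdQuot z)) ∧
      π.f * (d + lamO S (IwasawaAlgebraO S ⧸ Ideal.span {D})) ≤ lamTwo 2 (π.colocdQuot z) ∧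
      Module.Finite (FractionRing (coeffO S)) (TensorProduct (coeffO S) (FractionRing (coeffO S)) (zetaQuot I z)) ∧
      lamO S (zetaQuot I z) ≤ lamO S (CharacterModule ↥π.Sel₀) + lamO S (IwasawaAlgebraO S ⧸ Ideal.span {D}) := by
  haveI := hIfg
  have hCν : (PowerSeries.C ν : IwasawaAlgebraO S) ≠ 0 := fun h0 ↦ hν (by simpa using congrArg PowerSeries.constantCoeff h0)
  -- the column identity of the renormalised class `z := C ν • z₀`
  have hDLu : D * (Lm * u) ≠ 0 := mul_ne_zero hD (mul_ne_zero hLm hu)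
  have hcol : ∀ r : IwasawaAlgebraO S, e (π.cvec (r • ((PowerSeries.C ν : IwasawaAlgebraO S) • z₀))) = r * (D * (Lm * u)) := by
    intro r
    rw [← mul_smul, hlin _ z₀ (Submodule.mem_span_singleton_self z₀), mul_assoc, hval]
  -- the primitive class is `Λ_𝒪`-torsion-free, read off its column
  have hcol₀ : ∀ r : IwasawaAlgebraO S, e (π.cvec (r • z₀)) = r * e (π.cvec z₀) := fun r ↦
    hlin r z₀ (Submodule.mem_span_singleton_self z₀)
  have hez₀ : e (π.cvec z₀) ≠ 0 := by
    intro h0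
    apply hDLu
    rw [← hval, h0, mul_zero]
  have hz₀ : ∀ a : IwasawaAlgebraO S, a • z₀ = 0 → a = 0 :=
    torsionFree_of_column (fun x ↦ e (π.cvec x)) z₀ (e (π.cvec z₀)) hez₀ hcol₀
  refine ⟨(PowerSeries.C ν : IwasawaAlgebraO S) • z₀, D, hD, (hDesc _ _ hDLu hcol).1, ?_, ?_, ?_⟩
  · -- (i_D): `f·(d + λ(Λ/D)) ≤ f·(λ(Λ/u) + λ(Λ/L⁻) + λ(Λ/D)) = f·λ(Λ/(D·L⁻·u)) ≤ λ_{ℤ₂}(colocdQuot z)`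
    have h1 := (hDesc _ _ hDLu hcol).2
    have h2 : lamO S (IwasawaAlgebraO S ⧸ Ideal.span {D * (Lm * u)}) =
        lamO S (IwasawaAlgebraO S ⧸ Ideal.span {Lm * u}) + lamO S (IwasawaAlgebraO S ⧸ Ideal.span {D}) :=
      CharIdealLambda.finrank_baseChange_quotient_span_mul_eq_add (FractionRing (coeffO S)) hD (mul_ne_zero hLm hu)
    have h3 : lamO S (IwasawaAlgebraO S ⧸ Ideal.span {Lm * u}) =
        lamO S (IwasawaAlgebraO S ⧸ Ideal.span {u}) + lamO S (IwasawaAlgebraO S ⧸ Ideal.span {Lm}) :=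
      CharIdealLambda.finrank_baseChange_quotient_span_mul_eq_add (FractionRing (coeffO S)) hLm hu
    rw [h2, h3, hd] at h1
    calc π.f * (d + lamO S (IwasawaAlgebraO S ⧸ Ideal.span {D}))
        ≤ π.f * (lamO S (IwasawaAlgebraO S ⧸ Ideal.span {u}) + d + lamO S (IwasawaAlgebraO S ⧸ Ideal.span {D})) :=
          Nat.mul_le_mul_left _ (by omega)
      _ ≤ lamTwo 2 (π.colocdQuot ((PowerSeries.C ν : IwasawaAlgebraO S) • z₀)) := h1
  · -- finiteness of `Frac 𝒪 ⊗ 𝐇¹/Λ_𝒪 z` (torsion, hence finite after base change)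
    exact CharIdealLambda.finite_baseChange_of_isTorsion (FractionRing (coeffO S)) (zetaQuot I ((PowerSeries.C ν : IwasawaAlgebraO S) • z₀))
      (isTorsion_quotient_span_smul z₀ _ hCν htors)
  · -- (ii): `λ(𝐇¹/Λ C ν z₀) = λ(𝐇¹/Λ z₀) + λ(Λ/(C ν)) = λ(𝐇¹/Λ z₀) ≤ λ(Sel₀^∨) + λ(Λ/(D))`
    have h4 : lamO S (zetaQuot I ((PowerSeries.C ν : IwasawaAlgebraO S) • z₀)) =
        lamO S (zetaQuot I z₀) + lamO S (IwasawaAlgebraO S ⧸ Ideal.span {(PowerSeries.C ν : IwasawaAlgebraO S)}) :=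
      CharIdealLambda.finrank_baseChange_quotient_span_smul_eq_add (FractionRing (coeffO S)) z₀ hz₀ _ hCν htors
    have h5 : lamO S (IwasawaAlgebraO S ⧸ Ideal.span {(PowerSeries.C ν : IwasawaAlgebraO S)}) = 0 :=
      CharIdealLambda.finrank_baseChange_quotient_span_C_eq_zero (FractionRing (coeffO S)) hν
    rw [h4, h5, add_zero]
    exact hB

/-- **Corollary (B⁻ at the primitive class, k2-g20's `∃`-shaped (R)).** With child A delivered as `∃ ν D u, …` (the literal
conclusion of `hERL_of_mazurTateValues`) and child B as k1-g24's composite `CompositeB` at `z₀` (torsion ∧ `λ ≤ λ(Sel₀^∨)`,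
NO slack), S3″'s body follows — the reciprocity decoration `D` never touches the B-side class: NO COUPLING of the children
beyond the shared class `z₀`. [cite: Kato2004Asterisque, Thm. 12.5 (1)–(2) (pp. 221–222)] -/
theorem s3body_of_stations_prim [IsDiscreteValuationRing (coeffO S)] [IsAdicComplete (IsLocalRing.maximalIdeal (coeffO S)) (coeffO S)]
    [Module (coeffO S) I.H] [IsScalarTower (coeffO S) (IwasawaAlgebraO S) I.H]
    (π : OnePairPins S W κ γ S₀ n ρ Θ hΘ I Sg) {Lm : IwasawaAlgebraO S} {d : ℕ} (hLm : Lm ≠ 0)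
    (hd : lamO S (IwasawaAlgebraO S ⧸ Ideal.span {Lm}) = d)
    (hIfg : Module.Finite (IwasawaAlgebraO S) I.H) (z₀ : I.H)
    (e : (Fin n → PowerSeries ℤ_[2]) ≃+ IwasawaAlgebraO S)
    (hlin : ∀ (s : IwasawaAlgebraO S) (x : I.H), x ∈ Submodule.span (IwasawaAlgebraO S) ({z₀} : Set I.H) →
      e (π.cvec (s • x)) = s * e (π.cvec x))
    (hDesc : ∀ (z : I.H) (h : IwasawaAlgebraO S), h ≠ 0 → (∀ r : IwasawaAlgebraO S, e (π.cvec (r • z)) = r * h) →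
      Module.Finite ℚ_[2] (TensorProduct ℤ_[2] ℚ_[2] (π.colocdQuot z)) ∧
        π.f * lamO S (IwasawaAlgebraO S ⧸ Ideal.span {h}) ≤ lamTwo 2 (π.colocdQuot z))
    (hR : ∃ (ν : coeffO S) (D u : IwasawaAlgebraO S), ν ≠ 0 ∧ D ≠ 0 ∧ u ≠ 0 ∧
      PowerSeries.C ν * e (π.cvec z₀) = D * (Lm * u))
    (hB : Module.IsTorsion (IwasawaAlgebraO S) (zetaQuot I z₀) ∧ lamO S (zetaQuot I z₀) ≤ lamO S (CharacterModule ↥π.Sel₀)) :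
    ∃ (z : I.H) (D : IwasawaAlgebraO S), D ≠ 0 ∧ Module.Finite ℚ_[2] (TensorProduct ℤ_[2] ℚ_[2] (π.colocdQuot z)) ∧
      π.f * (d + lamO S (IwasawaAlgebraO S ⧸ Ideal.span {D})) ≤ lamTwo 2 (π.colocdQuot z) ∧
      Module.Finite (FractionRing (coeffO S)) (TensorProduct (coeffO S) (FractionRing (coeffO S)) (zetaQuot I z)) ∧
      lamO S (zetaQuot I z) ≤ lamO S (CharacterModule ↥π.Sel₀) + lamO S (IwasawaAlgebraO S ⧸ Ideal.span {D}) := by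
  obtain ⟨ν, D, u, hν, hD, hu, hval⟩ := hR
  exact s3body_of_stations π hLm hd hIfg z₀ e hlin hDesc ν D u hν hD hu hval hB.1 (hB.2.trans (Nat.le_add_right _ _))

/-- **Corollary (torsion for free from rank one).** If `rank_{Λ_𝒪} 𝐇¹ = 1` (Kato 12.4 (2), conjunct 2 of S3″: `thm12_4_newform`),
child B may be stated as the BARE inequality `λ_𝒪(𝐇¹/Λ_𝒪 z₀) ≤ λ_𝒪(Sel₀^∨) + λ_𝒪(Λ_𝒪/(D))`: the torsion of `𝐇¹/Λ_𝒪 z₀` is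
supplied by the glue (`isTorsion_quotient_span_of_rank_eq_one` ∘ `torsionFree_of_column`).
[cite: Kato2004Asterisque, Thm. 12.4 (2) (p. 221), Thm. 12.5 (pp. 221–222)] -/
theorem s3body_of_stations_rank_one [IsDiscreteValuationRing (coeffO S)] [IsAdicComplete (IsLocalRing.maximalIdeal (coeffO S)) (coeffO S)]
    [Module (coeffO S) I.H] [IsScalarTower (coeffO S) (IwasawaAlgebraO S) I.H]
    (π : OnePairPins S W κ γ S₀ n ρ Θ hΘ I Sg) {Lm : IwasawaAlgebraO S} {d : ℕ} (hLm : Lm ≠ 0)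
    (hd : lamO S (IwasawaAlgebraO S ⧸ Ideal.span {Lm}) = d)
    (hIfg : Module.Finite (IwasawaAlgebraO S) I.H) (hrk : Module.rank (IwasawaAlgebraO S) I.H = 1) (z₀ : I.H)
    (e : (Fin n → PowerSeries ℤ_[2]) ≃+ IwasawaAlgebraO S)
    (hlin : ∀ (s : IwasawaAlgebraO S) (x : I.H), x ∈ Submodule.span (IwasawaAlgebraO S) ({z₀} : Set I.H) →
      e (π.cvec (s • x)) = s * e (π.cvec x))
    (hDesc : ∀ (z : I.H) (h : IwasawaAlgebraO S), h ≠ 0 → (∀ r : IwasawaAlgebraO S, e (π.cvec (r • z)) = r * h) →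
      Module.Finite ℚ_[2] (TensorProduct ℤ_[2] ℚ_[2] (π.colocdQuot z)) ∧
        π.f * lamO S (IwasawaAlgebraO S ⧸ Ideal.span {h}) ≤ lamTwo 2 (π.colocdQuot z))
    (ν : coeffO S) (D u : IwasawaAlgebraO S) (hν : ν ≠ 0) (hD : D ≠ 0) (hu : u ≠ 0)
    (hval : PowerSeries.C ν * e (π.cvec z₀) = D * (Lm * u))
    (hB : lamO S (zetaQuot I z₀) ≤ lamO S (CharacterModule ↥π.Sel₀) + lamO S (IwasawaAlgebraO S ⧸ Ideal.span {D})) :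
    ∃ (z : I.H) (D : IwasawaAlgebraO S), D ≠ 0 ∧ Module.Finite ℚ_[2] (TensorProduct ℤ_[2] ℚ_[2] (π.colocdQuot z)) ∧
      π.f * (d + lamO S (IwasawaAlgebraO S ⧸ Ideal.span {D})) ≤ lamTwo 2 (π.colocdQuot z) ∧
      Module.Finite (FractionRing (coeffO S)) (TensorProduct (coeffO S) (FractionRing (coeffO S)) (zetaQuot I z)) ∧
      lamO S (zetaQuot I z) ≤ lamO S (CharacterModule ↥π.Sel₀) + lamO S (IwasawaAlgebraO S ⧸ Ideal.span {D}) := by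
  have hDLu : D * (Lm * u) ≠ 0 := mul_ne_zero hD (mul_ne_zero hLm hu)
  have hez₀ : e (π.cvec z₀) ≠ 0 := by
    intro h0
    apply hDLu
    rw [← hval, h0, mul_zero]
  have hz₀ : ∀ a : IwasawaAlgebraO S, a • z₀ = 0 → a = 0 :=
    torsionFree_of_column (fun x ↦ e (π.cvec x)) z₀ (e (π.cvec z₀)) hez₀
      (fun r ↦ hlin r z₀ (Submodule.mem_span_singleton_self z₀))
  exact s3body_of_stations π hLm hd hIfg z₀ e hlin hDesc ν D u hν hD hu hval
    (isTorsion_quotient_span_of_rank_eq_one hrk z₀ hz₀) hB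

end Assembly

end Summit.BirchSwinnertonDyer.BirchSwinnertonDyer.Cruxes.ResidualThetaCountLowerPureAtTwo.SideaK3G24

end
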